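import Summits.HodgeConjecture.HodgeConjecture.Theorems.Ring2HypothesesDescentMotivatedCorrespondenceLift
import Summits.HodgeConjecture.HodgeConjecture.Theorems.Ring2HypothesesDescentCurvePowers
import HarnessLib

/-!
# Ring 2 — hypotheses layer, descent axis: ROW b05 GOVERNS EXACTLY ARAPURA'S STRICT ABELIAN CLASS, and
# ROW b05 ⟺ «MOTIVATED ⟹ ALGEBRAIC ON THE CARTESIAN POWERS OF SMOOTH PROJECTIVE CURVES» (fact-free)

HONEST FRAMING (page 1, verbatim the cell's standing line): **research route conditional on HC_CM; not a
corollary; Q11.4-sentence-2 already refuted in dim ≥ 3.** Nothing in this file proves a case of the Hodge conjecture;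
nothing discharges the binder of record b05 `Ring2.Hypotheses.MotivatedImpliesAlgebraicAV` («motivated classes on complex
abelian varieties are algebraic», `Ring2HypothesesDescent.lean` :177; OPEN, «published modulo X», X = `B` on the compact
abelian pencils); the binder table's numbers do not move. `HC_CM` (`Theses.RankFourFaces.CMAbelianHodge`) does not occur
in this file; row b05 occurs only inside `↔` / as a displayed hypothesis and is NOT asserted.

Hodge ladder STAGE 3, `BINDER-OWNERS.md` row **b05**, seat `ring2-b05` (gen 40). Companion of
`Ring2HypothesesDescentMotivatedCorrespondenceLift.lean` (same gen: André's semisimplicity lift along algebraic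
correspondences and the descent of «`A_mot = A`» along `HodgeTheory.IsDominatedByPowers` — Arapura 2006 Lemma 4.2 with
that clause). Ring2-b06 gen 75 (`Ring2HypothesesDescentCurvePowers.lean`) read `HC_AV` — and row b06 granted c1 — on the
cartesian powers of curves through Arapura's Lemma 1.3 (`exists_curve_isDominatedByPowers_abelianVariety`: every complex
abelian variety is dominated by the powers of ONE smooth projective curve) and the tree's PROVED Hodge-class clause of
Lemma 4.2 (`CorCM.Stage4.hodgeConjectureFor_of_isDominatedByPowers`). Here the same on the MOTIVIC road, with the
companion's «`A_mot = A`» clause in place of the Hodge-class clause: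

* §1 `motivatedClasses_pow_le_algebraicClasses_of_motivatedImpliesAlgebraicAV` — row b05 gives «motivated ⟹ algebraic»
  on every cartesian power `A.X^e` (transport along `CorCM.Stage4.powSuccXIso : (A^{k+1}).X ≅ A.X^{k+1}`).
* §2 **`motivatedClasses_le_algebraicClasses_of_isDominatedByPowers_abelianVariety` — ROW b05 ⟹ «`A_mot = A`» ON EVERY
  SMOOTH PROJECTIVE COMPLEX VARIETY DOMINATED BY THE POWERS OF AN ABELIAN VARIETY, and on all its powers** (Arapura's
  strict abelian motivic class of `CorCM/Stage4*`: finite products of curves and abelian varieties, their powers, their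
  smooth surjective images, …); **`motivatedImpliesAlgebraicAV_iff_forall_isDominatedByPowers_abelianVariety` — row b05 IS
  the parent node `MotivatedImpliesAlgebraic` RESTRICTED TO THAT CLASS** (`⟸`: an abelian variety is dominated by its
  own powers, `CorCM.Stage4.isDominatedByPowers_self`).
* §3 **`motivatedImpliesAlgebraicAV_iff_curvePow` — ROW b05 ⟺ ON EVERY CARTESIAN POWER `Cᵏ` OF EVERY SMOOTH PROJECTIVE
  COMPLEX CURVE `C` EVERY MOTIVATED CLASS IS ALGEBRAIC**, hypothesis-free (`⟹`: `Cᵏ` is dominated by the powers of `J(C)`,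
  `CorCM.Stage4.isDominatedByPowers_curve_jacobian` + `isDominatedByPowers_pow_succ`, a Jacobian EXISTS —
  `nonempty_jacobian_of_isSmoothProjective_complex`; `⟸`: Arapura Lemma 1.3 first half + Lange–Birkenhake Prop. 4.5.8,
  the tree's THEOREM `exists_curve_isDominatedByPowers_abelianVariety`); `¬`-form (a counterexample to row b05, if any,
  lives on a power of a curve); PER ABELIAN VARIETY one curve decides `A` and all `A^{k+1}`
  (`exists_curve_motivatedClasses_le_algebraicClasses_of_curvePow`); PER CURVE the powers of `J(C)` decide the powers of
  `C` (`motivatedClasses_curvePow_le_algebraicClasses_of_jacobianPow`).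

WHY IT IS WORTH A LINE. The powers `Cᵏ` carry `H•(Cᵏ) = H•(C)^{⊗k}` and conjecture `B` HOLDS on them (Kleiman; the
tree's `standardConjectureBStar_curve` / `standardConjectureBStar_tensor`), yet «motivated ⟹ algebraic» on the `Cᵏ` is
EXACTLY row b05 — the auxiliary pieces `Y` of André's generators `pr_*(α ∪ *_L β)` on `Cᵏ × Y` are arbitrary, so
`B(Cᵏ)` alone does not decide it; this isolates, by name and fact-free, what row b05 asks beyond `B` of the test variety.

HONEST COLUMN. Nothing is discharged; row b05, `HC_AV`, X stay OPEN; row b05 is NOT asserted (it is unfolded inside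
`↔` or displayed as the hypothesis `h`); no definition, no named fact (new or displayed), no sorry; fact-free kernel
theorems. NOT obtained: a middle-degree curve-power form of row b05 (gen 34's `motivatedImpliesAlgebraicAV_iff_forall_middleDegree`
pads with elliptic factors, which leaves the class of curve powers), a bound on the genus or on the exponent `k`
(Lange–Birkenhake's curve is a linear section, genus unbounded; Serre's generation bound is not threaded).

PRESEARCH: as the companion — [corpus: `paper:arxiv-math_0501348` Arapura 2006 §1 Lemma 1.1 / 1.3, §4 Thm. 4.1,
Lemma 4.2, Cor. 4.4, re-opened this session; `paper:doi-10-1007-bf02698643` André 1996 Thm. 0.4, Thm. 0.6.2, §6.2];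
corpus hybrid/vector + galaxy all stars: no printed statement «HC-type reduction of `A_mot = A` on abelian varieties to
curve powers» found — certification by assembly, no novelty in print claimed.

References (bib keys): Arapura2006 (Introduction p. 762, §1 Lemma 1.1, Lemma 1.3, §4 Thm. 4.1, Lemma 4.2, Cor. 4.4),
Andre1996Motifs (Thm. 0.4 p. 7, Thm. 0.6.2 p. 9, Prop. 2.1 pp. 14–15, Prop. 3.3 pp. 21–22, §6.2 p. 31),
LangeBirkenhake1992 (Prop. 4.5.8), Milne1986JacobianVarieties (§6 Prop. 6.1, §10 Thm. 10.1), Kleiman1968AlgebraicCycles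
(Cor. 2A11), VoisinHodgeII2003 (Prop. 9.20–9.21, (10.7)).
-/

noncomputable section

set_option linter.dupNamespace false

open CategoryTheory AlgebraicGeometry MonoidalCategory CartesianMonoidalCategory
open Literature.AlgebraicGeometry Literature.AlgebraicGeometry.Motives
open Literature.AlgebraicGeometry.HodgeTheory
open Summit.HodgeConjecture.HodgeConjecture.Theorems
open Summit.HodgeConjecture.CorCM.Stage4 (powSuccXIso dim_powSucc' isDominatedByPowers_self
  isDominatedByPowers_pow_succ isDominatedByPowers_curve_jacobian)

namespace Summit.HodgeConjecture.HodgeConjecture.Ring2.Hypotheses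

/-! ## §1 Row b05 on the cartesian powers of an abelian variety -/

/-- **Row b05 gives «motivated ⟹ algebraic» on every cartesian power `A.X^e`** (dimension `e · dim A`) of the
underlying variety of a complex abelian variety: `A.X⁰ = Spec ℂ` carries no motivated class of positive codimension
(companion's `motivatedClasses_le_algebraicClasses_of_dim_zero`), and `A.X^{k+1} ≅ (A^{k+1}).X` is the variety of the
abelian variety `A.powSucc k` (`CorCM.Stage4.powSuccXIso`, `dim_powSucc'`), along which motivated and algebraic classes
transport (`map_mem_motivatedClasses_iff_of_iso`, `mem_algebraicClasses_map_iff_of_iso`). Row b05 is the displayed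
hypothesis `h`, NOT asserted. [cite: Andre1996Motifs, §2.1 Déf. 1 and Prop. 2.1 (p. 14)] -/
theorem motivatedClasses_pow_le_algebraicClasses_of_motivatedImpliesAlgebraicAV (h : MotivatedImpliesAlgebraicAV)
    (A : AbelianVariety ℂ) :
    ∀ e p : ℕ, motivatedClasses (e * A.dim) (A.X.pow e) p ≤ algebraicClasses (A.X.pow e) p
  | 0, p => by
    rw [Nat.zero_mul]
    exact motivatedClasses_le_algebraicClasses_of_dim_zero p
  | k + 1, p => by
    intro x hx
    have hB : IsSmoothProjective ((k + 1) * A.dim) (A.powSucc k).X := by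
      have h' : IsSmoothProjective (A.powSucc k).dim (A.powSucc k).X := AbelianVariety.isSmoothProjective_holds
      rwa [dim_powSucc'] at h'
    have hP : IsSmoothProjective ((k + 1) * A.dim) (A.X.pow (k + 1)) :=
      (AbelianVariety.isSmoothProjective_holds (A := A)).pow (k + 1)
    have hx' : complexBetti.map (powSuccXIso A k).hom (2 * p) x ∈
        motivatedClasses ((k + 1) * A.dim) (A.powSucc k).X p :=
      (map_mem_motivatedClasses_iff_of_iso hP hB (powSuccXIso A k) x).2 hx
    have halg : complexBetti.map (powSuccXIso A k).hom (2 * p) x ∈ algebraicClasses (A.powSucc k).X p := by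
      have hk := h (A.powSucc k) p
      rw [dim_powSucc'] at hk
      exact hk hx'
    exact (mem_algebraicClasses_map_iff_of_iso (powSuccXIso A k)).1 halg

/-! ## §2 Arapura's strict abelian class: row b05 is the parent node restricted to it -/

section Dominated

variable {m : ℕ} {V : SchemeOver ℂ}

/-- **ROW b05 ⟹ «`A_mot = A`» ON EVERY SMOOTH PROJECTIVE VARIETY DOMINATED BY THE POWERS OF A COMPLEX ABELIAN VARIETY**
(`HodgeTheory.IsDominatedByPowers m V A.dim A.X`: every `Hᵏ(V(ℂ); ℂ)` is spanned by images of algebraic correspondences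
from the powers of `A` — Arapura's strict abelian motivic type: finite products of curves and abelian varieties, their
powers, their smooth surjective images): the companion's descent `motivatedClasses_le_algebraicClasses_of_isDominatedByPowers`
fed with §1. Row b05 is the displayed hypothesis `h`, NOT asserted. [cite: Arapura2006, §4 Lemma 4.2 and §1 Lemma 1.1]
[cite: Andre1996Motifs, Thm. 0.4 (p. 7) and Prop. 3.3 (pp. 21–22)] -/
theorem motivatedClasses_le_algebraicClasses_of_isDominatedByPowers_abelianVariety (h : MotivatedImpliesAlgebraicAV)
    (hV : IsSmoothProjective m V) (A : AbelianVariety ℂ) (hdom : IsDominatedByPowers m V A.dim A.X) (p : ℕ) :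
    motivatedClasses m V p ≤ algebraicClasses V p :=
  motivatedClasses_le_algebraicClasses_of_isDominatedByPowers hV AbelianVariety.isSmoothProjective_holds hdom
    (motivatedClasses_pow_le_algebraicClasses_of_motivatedImpliesAlgebraicAV h A) p

/-- **… and on all positive cartesian powers `V^{k+1}`** (they are dominated by the powers of the same `A`,
`CorCM.Stage4.isDominatedByPowers_pow_succ`). Row b05 is the displayed hypothesis `h`, NOT asserted.
[cite: Arapura2006, §4 Lemma 4.2 and §1 Lemma 1.1] -/
theorem motivatedClasses_pow_le_algebraicClasses_of_isDominatedByPowers_abelianVariety (h : MotivatedImpliesAlgebraicAV)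
    (hV : IsSmoothProjective m V) (A : AbelianVariety ℂ) (hdom : IsDominatedByPowers m V A.dim A.X) (k p : ℕ) :
    motivatedClasses ((k + 1) * m) (V.pow (k + 1)) p ≤ algebraicClasses (V.pow (k + 1)) p :=
  motivatedClasses_le_algebraicClasses_of_isDominatedByPowers_abelianVariety h (hV.pow (k + 1)) A
    (isDominatedByPowers_pow_succ AbelianVariety.isSmoothProjective_holds hV hdom k) p

/-- **ROW b05 ⟺ THE PARENT NODE `MotivatedImpliesAlgebraic` RESTRICTED TO ARAPURA'S STRICT ABELIAN CLASS**: motivated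
classes are algebraic on every smooth projective complex variety dominated by the powers of some abelian variety iff
they are on abelian varieties (`⟸`: an abelian variety is dominated by its own powers, `CorCM.Stage4.isDominatedByPowers_self`).
Neither side is asserted. [cite: Arapura2006, §4 Lemma 4.2 and §1 Lemma 1.1] [cite: Andre1996Motifs, Thm. 0.6.2 (p. 9) and §6.2 (p. 31)] -/
theorem motivatedImpliesAlgebraicAV_iff_forall_isDominatedByPowers_abelianVariety :
    MotivatedImpliesAlgebraicAV ↔
      ∀ ⦃m : ℕ⦄ ⦃V : SchemeOver ℂ⦄ (A : AbelianVariety ℂ), IsSmoothProjective m V →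
        IsDominatedByPowers m V A.dim A.X → ∀ p : ℕ, motivatedClasses m V p ≤ algebraicClasses V p :=
  ⟨fun h _ _ A hV hdom p ↦ motivatedClasses_le_algebraicClasses_of_isDominatedByPowers_abelianVariety h hV A hdom p,
    fun h A p ↦ h A AbelianVariety.isSmoothProjective_holds
      (isDominatedByPowers_self AbelianVariety.isSmoothProjective_holds) p⟩

end Dominated

/-! ## §3 Row b05 is «motivated ⟹ algebraic» on the cartesian powers of smooth projective curves -/

section Curves

variable {C : SchemeOver ℂ}

/-- **Per curve: the powers of the Jacobian decide the powers of the curve.** If on every cartesian power of (the variety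
of) the Albanese variety `J` of an Albanese datum `𝒥 : Jacobian C` of a smooth projective complex curve `C` the motivated
classes are algebraic, then so they are on every `Cᵏ`: `Cᵏ` is dominated by the powers of `J`
(`CorCM.Stage4.isDominatedByPowers_curve_jacobian`, `isDominatedByPowers_pow_succ`; Arapura Lemma 1.3, second half) and the
companion's descent applies; `C⁰ = Spec ℂ` is `motivatedClasses_le_algebraicClasses_of_dim_zero`. The hypothesis on `J`
is NOT asserted. [cite: Arapura2006, §1 Lemma 1.3 and §4 Lemma 4.2] -/
theorem motivatedClasses_curvePow_le_algebraicClasses_of_jacobianPow (hC : IsSmoothProjective 1 C) (𝒥 : Jacobian C)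
    (hJ : ∀ e p : ℕ, motivatedClasses (e * 𝒥.J.dim) (𝒥.J.X.pow e) p ≤ algebraicClasses (𝒥.J.X.pow e) p)
    (k p : ℕ) : motivatedClasses k (C.pow k) p ≤ algebraicClasses (C.pow k) p := by
  cases k with
  | zero => exact motivatedClasses_le_algebraicClasses_of_dim_zero p
  | succ k =>
    have hdom := isDominatedByPowers_pow_succ (AbelianVariety.isSmoothProjective_holds (A := 𝒥.J)) hC
      (isDominatedByPowers_curve_jacobian hC 𝒥) k
    have hle := motivatedClasses_le_algebraicClasses_of_isDominatedByPowers (hC.pow (k + 1))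
      AbelianVariety.isSmoothProjective_holds hdom hJ p
    simpa only [Nat.mul_one] using hle

/-- **Row b05 gives «motivated ⟹ algebraic» on every cartesian power `Cᵏ` of every smooth projective complex curve**
(through the powers of a Jacobian of `C`, which exists: `nonempty_jacobian_of_isSmoothProjective_complex`). Row b05 is
the displayed hypothesis `h`, NOT asserted. [cite: Arapura2006, §1 Lemma 1.3 and §4 Lemma 4.2]
[cite: Milne1986JacobianVarieties, §1 Thm. 1.1 and §6 Prop. 6.1] -/
theorem motivatedClasses_curvePow_le_algebraicClasses_of_motivatedImpliesAlgebraicAV (h : MotivatedImpliesAlgebraicAV)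
    (hC : IsSmoothProjective 1 C) (k p : ℕ) : motivatedClasses k (C.pow k) p ≤ algebraicClasses (C.pow k) p := by
  obtain ⟨𝒥⟩ := nonempty_jacobian_of_isSmoothProjective_complex C hC
  exact motivatedClasses_curvePow_le_algebraicClasses_of_jacobianPow hC 𝒥
    (motivatedClasses_pow_le_algebraicClasses_of_motivatedImpliesAlgebraicAV h 𝒥.J) k p

/-- **ROW b05 ⟺ ON EVERY CARTESIAN POWER `Cᵏ` OF EVERY SMOOTH PROJECTIVE COMPLEX CURVE `C` EVERY MOTIVATED CLASS IS
ALGEBRAIC** — hypothesis-free. `⟹`: the previous theorem; `⟸`: every complex abelian variety `A` is dominated by the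
powers of a smooth projective curve (Arapura Lemma 1.3 + Lange–Birkenhake Prop. 4.5.8, the tree's THEOREM
`exists_curve_isDominatedByPowers_abelianVariety`), and «`A_mot = A`» descends along domination (companion,
`motivatedClasses_le_algebraicClasses_of_isDominatedByPowers`). Neither side is asserted.
[cite: Arapura2006, Introduction (p. 762), §1 Lemma 1.3 and §4 Lemma 4.2] [cite: LangeBirkenhake1992, Prop. 4.5.8]
[cite: Andre1996Motifs, Thm. 0.4 (p. 7) and Thm. 0.6.2 (p. 9)] -/
theorem motivatedImpliesAlgebraicAV_iff_curvePow :
    MotivatedImpliesAlgebraicAV ↔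
      ∀ (C : SchemeOver ℂ), IsSmoothProjective 1 C →
        ∀ k p : ℕ, motivatedClasses k (C.pow k) p ≤ algebraicClasses (C.pow k) p := by
  refine ⟨fun h C hC k p ↦ motivatedClasses_curvePow_le_algebraicClasses_of_motivatedImpliesAlgebraicAV h hC k p,
    fun h A p ↦ ?_⟩
  obtain ⟨C, hC, hdom⟩ := exists_curve_isDominatedByPowers_abelianVariety A
  exact motivatedClasses_le_algebraicClasses_of_isDominatedByPowers AbelianVariety.isSmoothProjective_holds hC hdom
    (fun e p' ↦ by simpa only [Nat.mul_one] using h C hC e p') p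

/-- **A counterexample to row b05, if any, can be taken on a cartesian power of a smooth projective curve** (the
`¬`-form). Nothing is asserted about row b05. [cite: Arapura2006, §1 Lemma 1.3 and §4 Lemma 4.2] [cite: LangeBirkenhake1992, Prop. 4.5.8] -/
theorem not_motivatedImpliesAlgebraicAV_iff_exists_curvePow :
    ¬ MotivatedImpliesAlgebraicAV ↔
      ∃ C : SchemeOver ℂ, IsSmoothProjective 1 C ∧
        ∃ k p : ℕ, ¬ (motivatedClasses k (C.pow k) p ≤ algebraicClasses (C.pow k) p) := by
  rw [motivatedImpliesAlgebraicAV_iff_curvePow]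
  push Not
  rfl

/-- **PER ABELIAN VARIETY, ONE CURVE DECIDES**: for every complex abelian variety `A` there is a smooth projective curve
`C` (a Lefschetz curve section of `A`; `A` is a quotient of `J(C)`) such that «motivated ⟹ algebraic» on all powers
`Cᵏ` gives «motivated ⟹ algebraic» on `A` and on all its positive powers `A.X^{k+1}`. The hypothesis on the `Cᵏ` is
NOT asserted. [cite: Arapura2006, §1 Lemma 1.3 and §4 Lemma 4.2] [cite: LangeBirkenhake1992, Prop. 4.5.8]
[cite: Milne1986JacobianVarieties, §10 Thm. 10.1] -/
theorem exists_curve_motivatedClasses_le_algebraicClasses_of_curvePow (A : AbelianVariety ℂ) :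
    ∃ C : SchemeOver ℂ, IsSmoothProjective 1 C ∧
      ((∀ k p : ℕ, motivatedClasses k (C.pow k) p ≤ algebraicClasses (C.pow k) p) →
        (∀ p : ℕ, motivatedClasses A.dim A.X p ≤ algebraicClasses A.X p) ∧
          ∀ k p : ℕ, motivatedClasses ((k + 1) * A.dim) (A.X.pow (k + 1)) p ≤ algebraicClasses (A.X.pow (k + 1)) p) := by
  obtain ⟨C, hC, hdom⟩ := exists_curve_isDominatedByPowers_abelianVariety A
  have hA : IsSmoothProjective A.dim A.X := AbelianVariety.isSmoothProjective_holds
  refine ⟨C, hC, fun h ↦ ⟨fun p ↦ ?_, fun k p ↦ ?_⟩⟩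
  · exact motivatedClasses_le_algebraicClasses_of_isDominatedByPowers hA hC hdom
      (fun e p' ↦ by simpa only [Nat.mul_one] using h e p') p
  · exact motivatedClasses_le_algebraicClasses_of_isDominatedByPowers (hA.pow (k + 1)) hC
      (isDominatedByPowers_pow_succ hC hA hdom k) (fun e p' ↦ by simpa only [Nat.mul_one] using h e p') p

end Curves

/-! ## Audit: nothing is decided here

Every theorem above is an implication out of the OPEN row b05 (displayed hypothesis `h`) or an equivalence between row
b05 and another OPEN statement; `MotivatedImpliesAlgebraicAV` is never proved, `HC_CM` / `HC_AV` do not occur. -/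

end Summit.HodgeConjecture.HodgeConjecture.Ring2.Hypotheses

end
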